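import Literature.AnabelianGeometry.AbsoluteAnabelian.AbsTopIProp23OuterFaithfulPrimeIndex
import HarnessLib

/-!
# [AbsTopI] Prop 2.3 (i) for orbicurve quotients: the homological binder (HOM) from (FAITH) and from (RG)

S. Mochizuki, *Topics in Absolute Anabelian Geometry I: Generalities* (2012) [AbsTopI] (lit key
`paper:url-11ac98ba15fc`), Def 2.1 (i) p. 17 (`X` a hyperbolic orbicurve, `Y → X` finite étale Galois with `Y`
a curve, `Δ_X ⊇ Δ_Y^Σ`), Prop 2.3 (i) p. 19 ("`Δ` is slim and elastic").

abc-iut cell, seat abc-iut-w5-d195 (gen 9); PROOF-ONLY (no definition, no named fact).  GAP-LEDGER row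
G-f051g4-1 (node AbsTopI:Prop2.3(i), ORBICURVE case of the Def 2.1 (i) construction): the tree proves
Prop 2.3 (i) at the GFG construction with an ARBITRARY discrete lattice `Γ` modulo the homological input
(HOM) «every `γ ∈ Γ ∖ j⁻¹U` moves a class of `H₁(j⁻¹U, ℤ)`» (p446316), and discharges (HOM) for curve lattices
(p445888) and for PRIME-index orbicurve quotients with one witness (p447728).  THIS FILE reshapes the binder
for a GENERAL orbicurve lattice in two ways, both index-free:

* `exists_conj_not_mem_commutator_of_not_commutator_sup_le`, `…_of_finrank_sup_lt` — the RELATIVE form of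
  the transfer-free central-extension lemma of p445378: for `γ ∈ N_Γ(H)` with `L := H·⟨γ⟩`, if
  `[L, L] ⊄ [H, H]` — in particular if `rank_ℤ H₁(L) < rank_ℤ H₁(H)` — then `γ` moves a class of `H₁(H, ℤ)`;
* `forall_exists_conj_not_mem_commutator_of_faithful_of_le` — **(FAITH) ⇒ (HOM)**: if `H ⊴ Γ` (ANY finite
  index) is `≅ Γ_{g,r}` hyperbolic and `Γ/H` acts FAITHFULLY on `H₁(H, ℤ)` («`Gal(Y₀/X)` acts faithfully on
  `H₁(Y₀, ℤ)`» for ONE curve cover `Y₀ → X`), then (HOM) holds at EVERY finite-index `M ⊴ Γ` inside `H` (every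
  curve `Y → Y₀ → X`); `GFGSurfaceModel.slim_and_elastic_of_faithful_lattice`,
  `exists_slim_and_elastic_gfgQuotient_of_faithful_lattice` — hence **(T1) `Z_D(π U) = 1`, (T3), (T4) `D` slim
  and elastic** at the Def 2.1 (i) construction for every open `U ⊴ P` with `j⁻¹U ≤ H` (p447728's
  `…_of_index_prime_lattice` is the case `[Γ : H]` prime, where (FAITH) ⟸ one witness by its
  `forall_exists_conj_not_mem_commutator_of_index_prime`; `faithful_of_forall_not_commutator_sup_le` is the
  index-free criterion «`[H·⟨γ⟩, H·⟨γ⟩] ⊄ [H, H]` for every `γ ∉ H`»);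
* `forall_exists_conj_not_mem_commutator_of_rankDrop` — **(RG) ⇒ (HOM) at EVERY torsion-free cover**, no
  reference cover: IF `Γ` satisfies the rank-drop property (RG) «for every finite-index normal `K ≅ Γ_{g,r}`
  (hyperbolic) and every subgroup `L > K`, `H₁(L, ℤ)` has finite rank `< rank H₁(K, ℤ)`», THEN every
  `γ ∉ M` moves a class of `H₁(M, ℤ)` for every finite-index normal `M ≅ Γ_{g,r}`;
  `GFGSurfaceModel.slim_and_elastic_of_rankDrop_lattice`, `exists_slim_and_elastic_gfgQuotient_of_rankDrop_lattice`
  — (T1)/(T3)/(T4) and the Def 2.1 (i) quotient for EVERY admissible `U`, modulo (RG) only.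

(RG) is a HYPOTHESIS BINDER here (an explicit `∀`-statement over subgroups of `Γ`, no definition, no fact).
For `Γ = π₁^{orb}(X)` the Fuchsian lattice of a hyperbolic orbicurve it is the classical strict growth of
`b₁` under finite covers `Y_K → [Y_K/(L/K)]`, a corollary of the Riemann–Hurwitz formula for Fuchsian groups
(Hoare–Karrass–Solitar, *Subgroups of finite index of Fuchsian groups*, Math. Z. 120 (1971)); Fuchsian
presentations are not in the tree, so (RG) stays the named residual of GAP G-f051g4-1 — in this exact shape.
HONEST SCOPE: model-level; classical (pro)finite group theory; OUR kernel check; nothing here bears on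
[IUTchIII] Cor. 3.12; no side is taken; typed ≠ proved elsewhere.
-/

noncomputable section

open Topology

universe u

namespace Literature.AnabelianGeometry.AbsoluteAnabelian

open Literature.AlgebraicGeometry.Frobenioids (IsSlimGroup)
open Literature.AnabelianGeometry.Anabelioids (IsSigmaInteger)
open Literature.AnabelianGeometry.SemiGraphs.SemiGraphOfAnabelioids
open Literature.AnabelianGeometry.SemiGraphs.SemiGraphOfAnabelioids.IsProSigmaCompletion
open Literature.GroupTheory.CombinatorialGroupTheory

/-! ### The relative rank-drop lemma -/

section Discrete

variable {Γ : Type*} [Group Γ]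

/-- **Relative central-extension lemma.**  Let `γ ∈ N_Γ(H)` and `L := H ⊔ ⟨γ⟩`.  If `[L, L] ⊄ [H, H]` then
`γ` moves a class of `H₁(H, ℤ)`: some `h ∈ H` has `γ h γ⁻¹ h⁻¹ ∉ [H, H]` (otherwise `L/[H,H]` is generated by
the central image of `H` and the image of `γ`, hence abelian — p445378's
`commutator_le_commutator_of_sup_zpowers_eq_top`, read inside the subgroup `L`).
[cite: MochizukiAbsTopI2012, Prop 2.3 (i) p.19] -/
theorem exists_conj_not_mem_commutator_of_not_commutator_sup_le (H : Subgroup Γ) {γ : Γ}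
    (hγN : γ ∈ Subgroup.normalizer (H : Set Γ))
    (hw : ¬ ⁅H ⊔ Subgroup.zpowers γ, H ⊔ Subgroup.zpowers γ⁆ ≤ ⁅H, H⁆) :
    ∃ h ∈ H, γ * h * γ⁻¹ * h⁻¹ ∉ ⁅H, H⁆ := by
  by_contra hall
  simp only [not_exists, not_and, not_not] at hall
  set Z : Subgroup Γ := Subgroup.zpowers γ with hZ
  set L : Subgroup Γ := H ⊔ Z with hL
  have hHL : H ≤ L := le_sup_left
  have hZL : Z ≤ L := le_sup_right
  have hγL : γ ∈ L := hZL (Subgroup.mem_zpowers γ)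
  have hLN : L ≤ Subgroup.normalizer (H : Set Γ) :=
    sup_le Subgroup.le_normalizer (Subgroup.zpowers_le.mpr hγN)
  haveI hHn : (H.subgroupOf L).Normal := (Subgroup.normal_subgroupOf_iff_le_normalizer hHL).mpr hLN
  set γ' : L := ⟨γ, hγL⟩ with hγ'
  have hZ' : Subgroup.zpowers γ' = Z.subgroupOf L := by
    apply le_antisymm
    · rw [Subgroup.zpowers_le, Subgroup.mem_subgroupOf]
      exact Subgroup.mem_zpowers γ
    · intro x hx
      rw [Subgroup.mem_subgroupOf, Subgroup.mem_zpowers_iff] at hx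
      obtain ⟨k, hk⟩ := hx
      rw [Subgroup.mem_zpowers_iff]
      exact ⟨k, Subtype.ext (by rw [Subgroup.coe_zpow]; exact hk)⟩
  have hsup : H.subgroupOf L ⊔ Subgroup.zpowers γ' = ⊤ := by
    rw [hZ', ← Subgroup.subgroupOf_sup hHL hZL]
    change L.subgroupOf L = ⊤
    exact Subgroup.subgroupOf_self (H := L)
  have htriv : ∀ h ∈ H.subgroupOf L,
      γ' * h * γ'⁻¹ * h⁻¹ ∈ ⁅H.subgroupOf L, H.subgroupOf L⁆ := by
    intro h hh
    rw [Subgroup.mem_subgroupOf] at hh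
    rw [mem_commutator_subgroupOf_iff hHL]
    exact hall h hh
  have hcomm : commutator L ≤ ⁅H.subgroupOf L, H.subgroupOf L⁆ :=
    commutator_le_commutator_of_sup_zpowers_eq_top (H.subgroupOf L) γ' hsup htriv
  -- push forward along `L ↪ Γ`
  apply hw
  have h1 : (⁅L, L⁆ : Subgroup Γ) = (commutator L).map L.subtype := by
    rw [commutator_def, Subgroup.map_commutator, ← MonoidHom.range_eq_map, Subgroup.range_subtype]
  have h2 : (⁅H.subgroupOf L, H.subgroupOf L⁆ : Subgroup L).map L.subtype = ⁅H, H⁆ := by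
    rw [Subgroup.map_commutator, Subgroup.map_subgroupOf_eq_of_le hHL]
  rw [h1, ← h2]
  exact Subgroup.map_mono hcomm

/-- **Relative rank-drop lemma.**  Let `γ ∈ N_Γ(H)` and `L := H ⊔ ⟨γ⟩`.  If `H₁(L, ℤ)` is a finite `ℤ`-module
with `rank_ℤ H₁(L, ℤ) < rank_ℤ H₁(H, ℤ)`, then `γ` moves a class of `H₁(H, ℤ)` (otherwise `[L, L] = [H, H]` and
`H^{ab} ↪ L^{ab}`, p445378's `finrank_abelianization_le_of_commutator_le`).
[cite: MochizukiAbsTopI2012, Prop 2.3 (i) p.19] -/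
theorem exists_conj_not_mem_commutator_of_finrank_sup_lt (H : Subgroup Γ) {γ : Γ}
    (hγN : γ ∈ Subgroup.normalizer (H : Set Γ))
    [Module.Finite ℤ (Additive (Abelianization ↥(H ⊔ Subgroup.zpowers γ)))]
    (hlt : Module.finrank ℤ (Additive (Abelianization ↥(H ⊔ Subgroup.zpowers γ))) <
      Module.finrank ℤ (Additive (Abelianization H))) :
    ∃ h ∈ H, γ * h * γ⁻¹ * h⁻¹ ∉ ⁅H, H⁆ := by
  refine exists_conj_not_mem_commutator_of_not_commutator_sup_le H hγN fun hle => ?_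
  set L : Subgroup Γ := H ⊔ Subgroup.zpowers γ with hL
  have hHL : H ≤ L := le_sup_left
  -- `[L, L] ≤ [H, H]`, read inside `L`
  have hcomm : commutator L ≤ ⁅H.subgroupOf L, H.subgroupOf L⁆ := by
    intro x hx
    rw [mem_commutator_subgroupOf_iff hHL]
    apply hle
    have hx' : (x : Γ) ∈ (commutator L).map L.subtype := Subgroup.mem_map_of_mem _ hx
    rwa [commutator_def, Subgroup.map_commutator, ← MonoidHom.range_eq_map, Subgroup.range_subtype] at hx'
  have hle' : Module.finrank ℤ (Additive (Abelianization (H.subgroupOf L))) ≤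
      Module.finrank ℤ (Additive (Abelianization L)) :=
    finrank_abelianization_le_of_commutator_le (H.subgroupOf L) hcomm
  have heq : Module.finrank ℤ (Additive (Abelianization (H.subgroupOf L))) =
      Module.finrank ℤ (Additive (Abelianization H)) :=
    (MulEquiv.toAdditive (Subgroup.subgroupOfEquivOfLe hHL).abelianizationCongr).toIntLinearEquiv.finrank_eq
  omega

/-! ### (FAITH) ⇒ (HOM) at every curve below the faithful cover -/

/-- **(FAITH) ⇒ (HOM).**  Let `H ⊴ Γ` with `H ≅ Γ_{g,r}` hyperbolic, and suppose `Γ/H` acts FAITHFULLY on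
`H₁(H, ℤ)`: every `γ ∉ H` moves a class of `H^{ab}`.  Then for every finite-index `M ⊴ Γ` with `M ≤ H`, every
`γ ∈ Γ ∖ M` moves a class of `H₁(M, ℤ)` (inside `H`: the curve case p445888; outside `H`: faithfulness at `H`,
then descent `exists_conj_not_mem_commutator_of_pow_mem`).  Index-free generalisation of p447728's
`forall_exists_conj_not_mem_commutator_of_index_prime_of_le` (same proof, adapted).
[cite: MochizukiAbsTopI2012, Prop 2.3 (i) p.19] -/
theorem forall_exists_conj_not_mem_commutator_of_faithful_of_le (H : Subgroup Γ) [hHn : H.Normal]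
    (hF : ∀ γ : Γ, γ ∉ H → ∃ h ∈ H, γ * h * γ⁻¹ * h⁻¹ ∉ ⁅H, H⁆) {g r : ℕ}
    (hgr : PuncturedSurfaceGroup.IsHyperbolicType g r) (eH : H ≃* PuncturedSurfaceGroup g r)
    (M : Subgroup Γ) [hMn : M.Normal] [M.FiniteIndex] (hMH : M ≤ H) :
    ∀ γ : Γ, γ ∉ M → ∃ m ∈ M, γ * m * γ⁻¹ * m⁻¹ ∉ ⁅M, M⁆ := by
  classical
  intro γ hγM
  -- `M` seen inside `H ≅ Γ_{g,r}`
  haveI hMHn : (M.subgroupOf H).Normal := hMn.subgroupOf H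
  have hidx : (M.subgroupOf H).index * H.index = M.index := Subgroup.relIndex_mul_index hMH
  haveI hMHfi : (M.subgroupOf H).FiniteIndex := ⟨fun h0 => by
    rw [h0, zero_mul] at hidx
    exact Subgroup.FiniteIndex.index_ne_zero hidx.symm⟩
  by_cases hγH : γ ∈ H
  · -- the curve case inside `H`, transported along `eH`
    set M' : Subgroup (PuncturedSurfaceGroup g r) := (M.subgroupOf H).map eH.toMonoidHom with hM'
    haveI : M'.FiniteIndex := ⟨by
      rw [hM', show eH.toMonoidHom = ((eH : H ≃* _) : H →* _) from rfl, Subgroup.index_map_equiv]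
      exact hMHfi.index_ne_zero⟩
    haveI hM'n : M'.Normal := hMHn.map eH.toMonoidHom eH.surjective
    set γ' : PuncturedSurfaceGroup g r := eH ⟨γ, hγH⟩ with hγ'
    have hγ'M : γ' ∉ M' := by
      intro hmem
      obtain ⟨x, hx, hxe⟩ := Subgroup.mem_map.mp hmem
      have : x = ⟨γ, hγH⟩ := eH.injective hxe
      rw [this, Subgroup.mem_subgroupOf] at hx
      exact hγM hx
    have hγ'N : γ' ∈ Subgroup.normalizer (M' : Set (PuncturedSurfaceGroup g r)) := by
      rw [Subgroup.normalizer_eq_top]; exact Subgroup.mem_top _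
    obtain ⟨h', hh', hwit⟩ := PuncturedSurfaceGroup.exists_conj_not_mem_commutator hgr M' γ' hγ'N hγ'M
    obtain ⟨x, hx, rfl⟩ := Subgroup.mem_map.mp hh'
    rw [Subgroup.mem_subgroupOf] at hx
    refine ⟨x, hx, fun hmem => hwit ?_⟩
    have hmemH : (⟨γ, hγH⟩ * x * ⟨γ, hγH⟩⁻¹ * x⁻¹ : H) ∈ ⁅M.subgroupOf H, M.subgroupOf H⁆ := by
      rw [mem_commutator_subgroupOf_iff hMH]
      exact hmem
    have := Subgroup.mem_map_of_mem eH.toMonoidHom hmemH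
    rw [Subgroup.map_commutator] at this
    simpa [hγ', hM', MulEquiv.toMonoidHom_eq_coe] using this
  · -- outside `H`: faithfulness at `H`, then descent to `M`
    haveI : (⊤ : Subgroup (PuncturedSurfaceGroup g r)).FiniteIndex := ⟨by rw [Subgroup.index_top]; exact one_ne_zero⟩
    obtain ⟨n, ⟨L⟩⟩ := PuncturedSurfaceGroup.exists_linearEquiv_abelianization_of_finiteIndex hgr ⊤
    let L' : Additive (Abelianization H) ≃ₗ[ℤ] (Fin n → ℤ) :=
      (MulEquiv.toAdditive (eH.trans Subgroup.topEquiv.symm).abelianizationCongr).toIntLinearEquiv.trans L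
    refine exists_conj_not_mem_commutator_of_pow_mem hMH L' (Nat.pos_of_ne_zero hMHfi.index_ne_zero)
      (fun h hh => ?_) (by rw [Subgroup.normalizer_eq_top]; exact Subgroup.mem_top γ) (hF γ hγH)
    have := Subgroup.pow_index_mem (M.subgroupOf H) ⟨h, hh⟩
    rw [Subgroup.mem_subgroupOf] at this
    simpa using this

/-- (FAITH) from a cyclic presentation: if `Γ/H` is generated by the class of ONE element `σ` (`H ⊔ ⟨σ⟩ = Γ`),
then `Γ/H` acts faithfully on `H₁(H, ℤ)` as soon as EVERY `γ ∉ H` satisfies `[H·⟨γ⟩, H·⟨γ⟩] ⊄ [H, H]` — and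
conversely this criterion needs no generator: it is just the relative central-extension lemma at each `γ`.
(For `[Γ : H]` prime every `γ ∉ H` has `H·⟨γ⟩ = Γ`, recovering p447728's prime-index criterion.)
[cite: MochizukiAbsTopI2012, Prop 2.3 (i) p.19] -/
theorem faithful_of_forall_not_commutator_sup_le (H : Subgroup Γ) [H.Normal]
    (hw : ∀ γ : Γ, γ ∉ H → ¬ ⁅H ⊔ Subgroup.zpowers γ, H ⊔ Subgroup.zpowers γ⁆ ≤ ⁅H, H⁆) :
    ∀ γ : Γ, γ ∉ H → ∃ h ∈ H, γ * h * γ⁻¹ * h⁻¹ ∉ ⁅H, H⁆ := fun γ hγ =>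
  exists_conj_not_mem_commutator_of_not_commutator_sup_le H
    (by rw [Subgroup.normalizer_eq_top]; exact Subgroup.mem_top γ) (hw γ hγ)

/-! ### (RG) ⇒ (HOM) at every torsion-free cover -/

/-- **(RG) ⇒ (HOM), no reference cover.**  Suppose `Γ` has the RANK-DROP property (RG): for every
finite-index normal `K ⊴ Γ` with `K ≅ Γ_{g,r}` hyperbolic and every subgroup `L > K`, `H₁(L, ℤ)` is a finite
`ℤ`-module of rank `< rank_ℤ H₁(K, ℤ)` (for the Fuchsian lattice of a hyperbolic orbicurve: Riemann–Hurwitz).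
Then for every finite-index normal `M ≅ Γ_{g,r}` (hyperbolic) every `γ ∈ Γ ∖ M` moves a class of `H₁(M, ℤ)`
— the binder (HOM) of p446316 at EVERY curve cover. [cite: MochizukiAbsTopI2012, Prop 2.3 (i) p.19] -/
theorem forall_exists_conj_not_mem_commutator_of_rankDrop
    (hRG : ∀ (K L : Subgroup Γ), K.Normal → K.FiniteIndex → K < L →
      (∃ g r : ℕ, PuncturedSurfaceGroup.IsHyperbolicType g r ∧ Nonempty (K ≃* PuncturedSurfaceGroup g r)) →
      Module.Finite ℤ (Additive (Abelianization L)) ∧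
        Module.finrank ℤ (Additive (Abelianization L)) < Module.finrank ℤ (Additive (Abelianization K)))
    (M : Subgroup Γ) [hMn : M.Normal] [M.FiniteIndex] {g r : ℕ}
    (hgr : PuncturedSurfaceGroup.IsHyperbolicType g r) (eM : M ≃* PuncturedSurfaceGroup g r) :
    ∀ γ : Γ, γ ∉ M → ∃ m ∈ M, γ * m * γ⁻¹ * m⁻¹ ∉ ⁅M, M⁆ := by
  intro γ hγ
  have hlt : M < M ⊔ Subgroup.zpowers γ :=
    lt_of_le_of_ne le_sup_left fun h =>
      hγ ((le_of_eq h.symm) (Subgroup.mem_sup_right (Subgroup.mem_zpowers γ)))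
  obtain ⟨hfin, hlt'⟩ := hRG M _ hMn inferInstance hlt ⟨g, r, hgr, ⟨eM⟩⟩
  haveI := hfin
  exact exists_conj_not_mem_commutator_of_finrank_sup_lt M
    (by rw [Subgroup.normalizer_eq_top]; exact Subgroup.mem_top γ) hlt'

end Discrete

/-! ### The GFG construction of Def 2.1 (i): (T1)/(T3)/(T4) from (FAITH) and from (RG) -/

namespace GFGSurfaceModel

open Literature.AnabelianGeometry.SemiGraphs.PSCDatum (IsMaxProSigmaQuotient)
open Literature.GroupTheory.ProfiniteSubquotients

variable {Sigma Sigma' : Set ℕ} {Γ : Type*} [Group Γ]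
  {P : Type u} [Group P] [TopologicalSpace P] [IsTopologicalGroup P] [CompactSpace P]
  [TotallyDisconnectedSpace P]
  {D : Type u} [Group D] [TopologicalSpace D] [IsTopologicalGroup D] [CompactSpace D] [T2Space D]
  [TotallyDisconnectedSpace D]
  {j : Γ →* P} {π : P →* D} {U : Subgroup P}

/-- **[AbsTopI] Prop 2.3 (i) at the Def 2.1 (i) construction below a FAITHFUL curve cover, outright.**
`j : Γ → P` a pro-`Σ′` completion of a lattice `Γ` with `H ⊴ Γ` of finite index, `H ≅ Γ_{g,r}` hyperbolic, and
`Γ/H` acting faithfully on `H₁(H, ℤ)`; `U ⊴ P` open with `j⁻¹U ≤ H` (a curve `Y → Y₀ → X`); `π : P ↠ D`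
continuous, `ker π ≤ U`, presenting the maximal pro-`Σ` quotient on `U` (`Σ ⊆ Σ′` nonempty sets of primes).
Then `Z_D(π U) = 1`, `D` has no nontrivial finite normal subgroup, and `D` is slim and elastic.
[cite: MochizukiAbsTopI2012, Prop 2.3 (i) p.19] -/
theorem slim_and_elastic_of_faithful_lattice (hSS : Sigma ⊆ Sigma') (hS : Sigma.Nonempty)
    (hSp : ∀ q ∈ Sigma, q.Prime) (hj : IsProSigmaCompletion Sigma' j) (H : Subgroup Γ) [H.Normal]
    (hF : ∀ γ : Γ, γ ∉ H → ∃ h ∈ H, γ * h * γ⁻¹ * h⁻¹ ∉ ⁅H, H⁆) {g r : ℕ}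
    (hgr : PuncturedSurfaceGroup.IsHyperbolicType g r) (eH : H ≃* PuncturedSurfaceGroup g r)
    [hUn : U.Normal] (hUo : IsOpen (U : Set P)) (hUH : U.comap j ≤ H) (hπc : Continuous π)
    (hπs : Function.Surjective π) (hker : π.ker ≤ U) (hmax : IsMaxProSigmaQuotient Sigma (π.subgroupMap U)) :
    Subgroup.centralizer ((U.map π : Subgroup D) : Set D) = ⊥ ∧
      (∀ N : Subgroup D, N.Normal → (N : Set D).Finite → N = ⊥) ∧ IsSlimGroup D ∧ IsElastic D := by
  classical
  haveI : (U.comap j).FiniteIndex := finiteIndex_comap hj U hUo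
  haveI hMn : (U.comap j).Normal := hUn.comap j
  -- `j⁻¹U`, a finite-index subgroup of `H ≅ Γ_{g,r}`, is `≅ Γ_{g',r'}` hyperbolic
  set M' : Subgroup (PuncturedSurfaceGroup g r) := ((U.comap j).subgroupOf H).map eH.toMonoidHom with hM'
  have hidx : ((U.comap j).subgroupOf H).index * H.index = (U.comap j).index :=
    Subgroup.relIndex_mul_index hUH
  haveI hfi : ((U.comap j).subgroupOf H).FiniteIndex := ⟨fun h0 => by
    rw [h0, zero_mul] at hidx
    exact Subgroup.FiniteIndex.index_ne_zero hidx.symm⟩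
  haveI : M'.FiniteIndex := ⟨by
    rw [hM', show eH.toMonoidHom = ((eH : H ≃* _) : H →* _) from rfl, Subgroup.index_map_equiv]
    exact hfi.index_ne_zero⟩
  obtain ⟨g', r', θ, -, -, hgr', hθ, hrange, -⟩ :=
    puncturedSurfaceGroupFiniteIndexSubgroup_holds g r hgr M' inferInstance
  let e : U.comap j ≃* PuncturedSurfaceGroup g' r' :=
    (((Subgroup.subgroupOfEquivOfLe hUH).symm.trans (eH.subgroupMap ((U.comap j).subgroupOf H))).trans
      (MulEquiv.subgroupCongr hrange.symm)).trans (MonoidHom.ofInjective hθ).symm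
  have hHom := forall_exists_conj_not_mem_commutator_of_faithful_of_le H hF hgr eH (U.comap j) hUH
  exact ⟨centralizer_map_eq_bot_of_homological hSS hS hSp hj hUo hgr' e hπc hπs hker hmax hHom,
    forall_finite_normal_eq_bot_of_homological hSS hS hSp hj hUo hgr' e hπc hπs hker hmax hHom,
    slim_and_elastic_of_homological hSS hS hSp hj hUo hgr' e hπc hπs hker hmax hHom⟩

/-- **[AbsTopI] Prop 2.3 (i) at the Def 2.1 (i) construction for a RANK-DROP lattice, at EVERY curve cover.**
`j : Γ → P` a pro-`Σ′` completion of a lattice `Γ` with the rank-drop property (RG); `U ⊴ P` open with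
`j⁻¹U ≅ Γ_{g,r}` hyperbolic (ANY curve `Y → X`); `π : P ↠ D` continuous, `ker π ≤ U`, presenting the maximal
pro-`Σ` quotient on `U`.  Then `Z_D(π U) = 1`, `D` has no nontrivial finite normal subgroup, and `D` is slim
and elastic — modulo (RG) only. [cite: MochizukiAbsTopI2012, Prop 2.3 (i) p.19] -/
theorem slim_and_elastic_of_rankDrop_lattice (hSS : Sigma ⊆ Sigma') (hS : Sigma.Nonempty)
    (hSp : ∀ q ∈ Sigma, q.Prime) (hj : IsProSigmaCompletion Sigma' j)
    (hRG : ∀ (K L : Subgroup Γ), K.Normal → K.FiniteIndex → K < L →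
      (∃ g r : ℕ, PuncturedSurfaceGroup.IsHyperbolicType g r ∧ Nonempty (K ≃* PuncturedSurfaceGroup g r)) →
      Module.Finite ℤ (Additive (Abelianization L)) ∧
        Module.finrank ℤ (Additive (Abelianization L)) < Module.finrank ℤ (Additive (Abelianization K)))
    {g r : ℕ} [hUn : U.Normal] (hUo : IsOpen (U : Set P)) (hgr : PuncturedSurfaceGroup.IsHyperbolicType g r)
    (e : U.comap j ≃* PuncturedSurfaceGroup g r) (hπc : Continuous π) (hπs : Function.Surjective π)
    (hker : π.ker ≤ U) (hmax : IsMaxProSigmaQuotient Sigma (π.subgroupMap U)) :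
    Subgroup.centralizer ((U.map π : Subgroup D) : Set D) = ⊥ ∧
      (∀ N : Subgroup D, N.Normal → (N : Set D).Finite → N = ⊥) ∧ IsSlimGroup D ∧ IsElastic D := by
  haveI : (U.comap j).FiniteIndex := finiteIndex_comap hj U hUo
  haveI hMn : (U.comap j).Normal := hUn.comap j
  have hHom := forall_exists_conj_not_mem_commutator_of_rankDrop hRG (U.comap j) hgr e
  exact ⟨centralizer_map_eq_bot_of_homological hSS hS hSp hj hUo hgr e hπc hπs hker hmax hHom,
    forall_finite_normal_eq_bot_of_homological hSS hS hSp hj hUo hgr e hπc hπs hker hmax hHom,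
    slim_and_elastic_of_homological hSS hS hSp hj hUo hgr e hπc hπs hker hmax hHom⟩

end GFGSurfaceModel

/-! ### The Def 2.1 (i) quotient for a rank-drop lattice -/

/-- **[AbsTopI] Prop 2.3 (i) for the orbicurve `X = [Y/Gal(Y/X)]` of a RANK-DROP lattice at the Def 2.1 (i)
GFG construction.**  For a lattice `Γ` with the rank-drop property (RG), nonempty sets of primes `Σ ⊆ Σ′`,
ANY pro-`Σ′` completion `j : Γ → P` (`P` profinite) and ANY open `U ⊴ P` with `j⁻¹U ≅ Γ_{g,r}` hyperbolic
(a curve `Y → X`): the almost pro-`Σ`-maximal quotient `D = P/K` of Def 2.1 (i) (`K = K_Σ(U)`,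
`GFGSurfaceModel.exists_gfgQuotient`) is slim and elastic and has no nontrivial finite normal subgroup.
[cite: MochizukiAbsTopI2012, Prop 2.3 (i) p.19] -/
theorem exists_slim_and_elastic_gfgQuotient_of_rankDrop_lattice {Γ : Type*} [Group Γ]
    (hRG : ∀ (K L : Subgroup Γ), K.Normal → K.FiniteIndex → K < L →
      (∃ g r : ℕ, PuncturedSurfaceGroup.IsHyperbolicType g r ∧ Nonempty (K ≃* PuncturedSurfaceGroup g r)) →
      Module.Finite ℤ (Additive (Abelianization L)) ∧
        Module.finrank ℤ (Additive (Abelianization L)) < Module.finrank ℤ (Additive (Abelianization K)))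
    {Sigma Sigma' : Set ℕ} (hSS : Sigma ⊆ Sigma') (hS : Sigma.Nonempty) (hSp : ∀ q ∈ Sigma, q.Prime)
    {P : Type u} [Group P] [TopologicalSpace P] [IsTopologicalGroup P] [CompactSpace P] [T2Space P]
    [TotallyDisconnectedSpace P] {j : Γ →* P} (hj : IsProSigmaCompletion Sigma' j)
    (U : Subgroup P) [U.Normal] (hUo : IsOpen (U : Set P)) {g r : ℕ}
    (hgr : PuncturedSurfaceGroup.IsHyperbolicType g r) (e : U.comap j ≃* PuncturedSurfaceGroup g r) :
    ∃ (K : Subgroup P) (_ : K.Normal) (_ : IsClosed (K : Set P)), K ≤ U ∧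
      Literature.AnabelianGeometry.SemiGraphs.PSCDatum.IsMaxProSigmaQuotient Sigma
        ((QuotientGroup.mk' K).subgroupMap U) ∧
      IsSlimGroup (P ⧸ K) ∧ IsElastic (P ⧸ K) ∧
      ∀ N : Subgroup (P ⧸ K), N.Normal → (N : Set (P ⧸ K)).Finite → N = ⊥ := by
  obtain ⟨K, hKn, hKc, hKU, hmax⟩ := GFGSurfaceModel.exists_gfgQuotient Sigma U hUo
  haveI := hKn
  haveI : IsClosed ((K : Subgroup P) : Set P) := hKc
  haveI : TotallyDisconnectedSpace (P ⧸ K) :=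
    Literature.GroupTheory.ProfiniteSubquotients.totallyDisconnectedSpace_quotient K hKc
  have hker : (QuotientGroup.mk' K).ker ≤ U := by rw [QuotientGroup.ker_mk']; exact hKU
  obtain ⟨-, hFN, hs, he⟩ := GFGSurfaceModel.slim_and_elastic_of_rankDrop_lattice hSS hS hSp hj hRG hUo hgr e
    QuotientGroup.continuous_mk (QuotientGroup.mk'_surjective K) hker hmax
  exact ⟨K, hKn, hKc, hKU, hmax, hs, he, hFN⟩

/-- **[AbsTopI] Prop 2.3 (i) for an orbicurve below a FAITHFUL curve cover at the Def 2.1 (i) GFG construction.**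
For `H ⊴ Γ` of finite index with `H ≅ Γ_{g,r}` hyperbolic and `Γ/H` acting faithfully on `H₁(H, ℤ)` (for
`[Γ : H]` prime this is p447728's `forall_exists_conj_not_mem_commutator_of_index_prime` from one witness),
nonempty sets of primes `Σ ⊆ Σ′`, ANY pro-`Σ′` completion `j : Γ → P` (`P` profinite) and ANY open `U ⊴ P` with
`j⁻¹U ≤ H` (a curve `Y → Y₀ → X`): the almost pro-`Σ`-maximal quotient `D = P/K` of Def 2.1 (i) is slim and
elastic and has no nontrivial finite normal subgroup. [cite: MochizukiAbsTopI2012, Prop 2.3 (i) p.19] -/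
theorem exists_slim_and_elastic_gfgQuotient_of_faithful_lattice {Γ : Type*} [Group Γ]
    (H : Subgroup Γ) [H.Normal] (hF : ∀ γ : Γ, γ ∉ H → ∃ h ∈ H, γ * h * γ⁻¹ * h⁻¹ ∉ ⁅H, H⁆)
    {g r : ℕ} (hgr : PuncturedSurfaceGroup.IsHyperbolicType g r) (eH : H ≃* PuncturedSurfaceGroup g r)
    {Sigma Sigma' : Set ℕ} (hSS : Sigma ⊆ Sigma') (hS : Sigma.Nonempty) (hSp : ∀ q ∈ Sigma, q.Prime)
    {P : Type u} [Group P] [TopologicalSpace P] [IsTopologicalGroup P] [CompactSpace P] [T2Space P]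
    [TotallyDisconnectedSpace P] {j : Γ →* P} (hj : IsProSigmaCompletion Sigma' j)
    (U : Subgroup P) [U.Normal] (hUo : IsOpen (U : Set P)) (hUH : U.comap j ≤ H) :
    ∃ (K : Subgroup P) (_ : K.Normal) (_ : IsClosed (K : Set P)), K ≤ U ∧
      Literature.AnabelianGeometry.SemiGraphs.PSCDatum.IsMaxProSigmaQuotient Sigma
        ((QuotientGroup.mk' K).subgroupMap U) ∧
      IsSlimGroup (P ⧸ K) ∧ IsElastic (P ⧸ K) ∧
      ∀ N : Subgroup (P ⧸ K), N.Normal → (N : Set (P ⧸ K)).Finite → N = ⊥ := by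
  obtain ⟨K, hKn, hKc, hKU, hmax⟩ := GFGSurfaceModel.exists_gfgQuotient Sigma U hUo
  haveI := hKn
  haveI : IsClosed ((K : Subgroup P) : Set P) := hKc
  haveI : TotallyDisconnectedSpace (P ⧸ K) :=
    Literature.GroupTheory.ProfiniteSubquotients.totallyDisconnectedSpace_quotient K hKc
  have hker : (QuotientGroup.mk' K).ker ≤ U := by rw [QuotientGroup.ker_mk']; exact hKU
  obtain ⟨-, hFN, hs, he⟩ := GFGSurfaceModel.slim_and_elastic_of_faithful_lattice hSS hS hSp hj H hF hgr eH
    hUo hUH QuotientGroup.continuous_mk (QuotientGroup.mk'_surjective K) hker hmax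
  exact ⟨K, hKn, hKc, hKU, hmax, hs, he, hFN⟩

end Literature.AnabelianGeometry.AbsoluteAnabelian

end
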